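import Literature.AlgebraicGeometry.Motives.ChowCorrespondences
import Literature.AlgebraicGeometry.Motives.CorrespondencesTransposeProofs
import Literature.AlgebraicGeometry.Motives.CorrespondencesTraceFormula
import Mathlib.LinearAlgebra.Trace
import HarnessLib

/-!
# The Lefschetz trace formula for a composite of correspondences:
# `⟨u · ᵗw⟩ = Σ_i (-1)^i Tr(u_* ∘ w_* | Hⁱ(X))` (Jannsen 1992, Lemma 1; Kleiman 1968, Prop. 1.3.6)

Topic `Literature/AlgebraicGeometry/Motives`, namespace
`Literature.AlgebraicGeometry.Motives.WeilCohomology` (the axiomatic Weil cohomology theories of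
`Motives/WeilCohomology`; correspondences act through `Motives/ChowCorrespondences.corrOp`).

Sources read on the page.

* U. Jannsen, *Motives, numerical equivalence, and semi-simplicity*, Invent. Math. **107** (1992)
  [Jannsen1992Motives], held text `paper:doi-10-1007-bf01231898`, p. 448: "The following formula is
  well-known, see, e.g. [K1] 1.3.6. **Lemma 1.** Let `B^{dim(X)}(X × X) → B^{dim(X)}(X × X)`,
  `f ↦ ᵗf`, be the transposition, induced by interchanging the factors of `X × X`. Then for
  `f, g ∈ B^{dim(X)}(X × X)` one has `⟨f · ᵗg⟩ = Σ_{i=0}^{2dim(X)} (-1)^i Tr_i(f ∘ g)`, where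
  `Tr_i(f)` is the trace of `f` acting on `H^i(X)`." (p. 447: the composition law
  `(f, g) ↦ g ∘ f = (p₁₃)_*(p₁₂* f · p₂₃* g)`.)
* S. Kleiman, *Algebraic cycles and the Weil conjectures*, in: Dix exposés (1968)
  [Kleiman1968AlgebraicCycles], §1.3 (a correspondence `u` on `X × Y` acts by
  `u(x) = pr₂₊(pr₁* x · u)`; the transpose `ᵗu`), Prop. 1.3.6 (Lefschetz trace formula).
* B. Kahn, *Zeta and L-functions of varieties and motives* (2020) [Kahn2020], §3.5.2–3.5.3,
  (3.5.3) `(v ⊗ w)(x) = ⟨x, v⟩ w`, (3.5.4) (Koszul sign of the transposition), Lemma 3.48.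

## Statement (the tree's vocabulary)

For `X` smooth projective of dimension `n` over `k` and a Weil cohomology theory
`W : WeilCohomology k K` (`char K = 0`), a class `u ∈ H²ⁿ(X × X)` ACTS on every `Hⁱ(X)` by the
tree's constructed operator `u_* = W.corrOp hX n n u i i = pr₂₊(pr₁* (·) ∪ u)` (Kleiman's pairing
form `W.IsInducedBy`: `tr_X(u_* x ∪ y) = tr_{X×X}((pr₁* x ∪ u) ∪ pr₂* y)`), and the transpose is
`ᵗw = W.transposeClass w = σ* w`, `σ` the swap of the factors. The theorem:

  `tr_{X×X}(u ∪ ᵗw) = Σ_{i=0}^{2n} (-1)^i Tr(u_* ∘ w_* | Hⁱ(X))`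

(`trace_cup_transposeClass_eq_sum_trace_corrOp_comp`), and its relational form for ANY
degree-preserving operators `S`, `T` induced by `u`, `w` (`…_of_isInducedBy`; the operators are
unique, `ChowCorrespondences.eq_of_isInducedBy_of_isInducedBy`). With `u`, `w` the classes of
correspondences `f`, `g` and `f ∘ g` read as the composite operator `f_* ∘ g_*` — the composite
correspondence acts by the composite operator (Kleiman §1.3; the tree's
`isInducedBy_comp_corrComp`) — this is Jannsen's Lemma 1 `⟨f · ᵗg⟩ = Σ (-1)^i Tr_i(f ∘ g)`; for
`w = Δ` (so `w_* = id`, `ᵗΔ` again inducing the identity) it is the tree's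
`trace_cup_eq_sum_trace_of_isInducedBy` (Kleiman 1.3.6 for a single correspondence).

Proof: both sides are bilinear in `(u, w)`; by Künneth induction (axiom (B)) it suffices to treat
external products `u = pr₁* a ∪ pr₂* b`, `w = pr₁* c ∪ pr₂* d`, where `(a ⊠ b)_*` is the rank-one
operator `x ↦ tr_X(x ∪ a) · b` on `H^{|b|}(X)` and `0` in the other degrees
(`corrOp_externalCup_apply`, `corrOp_externalCup_eq_zero`; Kahn (3.5.3)), the trace of a composite
of two rank-one operators is `tr(d ∪ a) · tr(b ∪ c)` (`LinearMap.trace_smulRight`), and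
`σ*(c ⊠ d) = (-1)^{|c||d|} d ⊠ c` (Kahn (3.5.4), the tree's `transposeClass_externalCup`); the
signs `(-1)^{|c||d|} = (-1)^{(2n-i)i} = (-1)^i` agree.

## What is proved (theorems only; no definition, no named fact, no `sorry`)

* `corrOp_externalCup_apply`, `corrOp_externalCup_eq_zero` — the operator of an external product;
* `transposeClass_transposeClass` — `ᵗᵗw = w`; `transposeClass_add/_smul` bookkeeping;
* `sum_trace_corrOp_externalCup_comp_corrOp_externalCup(_of_ne)`,
  `trace_externalCup_cup_transposeClass_externalCup(_of_ne)` — the two sides on generators;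
* **`trace_cup_transposeClass_eq_sum_trace_corrOp_comp`** — Lemma 1 for the constructed actions;
* **`trace_cup_transposeClass_eq_sum_trace_comp_of_isInducedBy`** — Lemma 1 for any induced
  degree-preserving operators;
* `sum_trace_comp_comm`, `trace_cup_transposeClass_comm` — the symmetry `⟨u · ᵗw⟩ = ⟨w · ᵗu⟩` it
  implies; `trace_cup_eq_sum_trace_comp_of_isInducedBy_transposeClass` (`⟨f · h⟩ = Σ (-1)^i Tr_i(f ∘ ᵗh)`).

## References

* [Jannsen1992Motives] U. Jannsen, Invent. Math. 107 (1992) 447–452 — Lemma 1 (p. 448), p. 447.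
* [Kleiman1968AlgebraicCycles] S. Kleiman, *Algebraic cycles and the Weil conjectures* (1968) —
  §1.3, Prop. 1.3.6.
* [Kahn2020] B. Kahn, *Zeta and L-functions of varieties and motives* (2020) — §3.5.2 (3.5.3),
  §3.5.3 (3.5.4), Lemma 3.48.

## Provenance

Lane `lit-hodgefound` (summit `HodgeConjecture`, Track 2 foundations library, Layer B: motives),
seat `lit-hodgefound-p29` (literature-prover, generation 34, row g34-#2). Companion of
`Motives/CorrespondenceAlgebraModNumericalSemisimple` (Jannsen's Theorem 1).
-/

universe u v

open CategoryTheory AlgebraicGeometry MonoidalCategory CartesianMonoidalCategory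
open scoped TensorProduct

noncomputable section

namespace Literature.AlgebraicGeometry.Motives

namespace WeilCohomology

variable {k : Type u} [Field k] {K : Type v} [Field K] [CharZero K] (W : WeilCohomology k K)
variable {n : ℕ} {X : SchemeOver k}

/-! ## The operator of an external product `pr₁* a ∪ pr₂* b` -/

section ExternalCup

/-- **The correspondence `a ⊠ b = pr₁* a ∪ pr₂* b` acts by the rank-one operator
`x ↦ tr_X(x ∪ a) · b` on `H^{|b|}(X)`** (Kahn 2020 (3.5.3) "`(v ⊗ w)(x) = ⟨x, v⟩ w`"; Kleiman 1968
§1.3): for `a ∈ Hˢ(X)`, `b ∈ Hᵗ(X)`, `s + t = 2n` and `x ∈ Hᵗ(X)`,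
`(a ⊠ b)_* x = tr_X(x ∪ a) · b`. Both sides are induced by `a ⊠ b` in Kleiman's pairing sense
(`isInducedBy_corrOp`; `trace_cup_cup_externalCup_of_eq`), hence agree (Poincaré duality).
[cite: Kahn2020, §3.5.2 formula (3.5.3)] [cite: Kleiman1968AlgebraicCycles, §1.3] -/
theorem corrOp_externalCup_apply (hX : IsSmoothProjective n X) {s t : ℕ} (hst : s + t = 2 * n)
    (hts : t + s = 2 * n) (a : W.obj X s) (b : W.obj X t) (x : W.obj X t) :
    W.corrOp hX n n (W.externalCup X X hst a b) t t x = W.cupPairing X n t s hts x a • b := by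
  have hind : W.IsInducedBy n n (W.externalCup X X hst a b)
      (((W.cupPairing X n t s hts).flip a).smulRight b) hts
      (show t + 2 * n + s = 2 * (n + n) by omega) := by
    intro y z
    simp only [LinearMap.smulRight_apply, LinearMap.flip_apply, map_smul, LinearMap.smul_apply,
      smul_eq_mul, cupPairing_apply]
    rw [W.trace_cup_cup_externalCup_of_eq hX hX hst _ hts hts]
  have h := W.eq_of_isInducedBy_of_isInducedBy hX
    (W.isInducedBy_corrOp hX (nX := n) (c := n) (i := t) (j := t) (by omega) hts
      (show t + 2 * n + s = 2 * (n + n) by omega) (W.externalCup X X hst a b)) hind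
  rw [h, LinearMap.smulRight_apply, LinearMap.flip_apply]

/-- Off the degree `|b|` the correspondence `a ⊠ b` acts by `0`: for `i ≠ t = |b|`,
`(a ⊠ b)_* = 0` on `Hⁱ(X)` (the Kleiman pairing `tr((pr₁* x ∪ (a ⊠ b)) ∪ pr₂* y)` vanishes off
the top bidegree, `trace_cup_cup_externalCup_of_ne`; above degree `2n` the operator is `0` by
definition). [cite: Kahn2020, §3.5.2 formula (3.5.3)] [cite: Kleiman1968AlgebraicCycles, §1.3] -/
theorem corrOp_externalCup_eq_zero (hX : IsSmoothProjective n X) {s t i : ℕ} (hst : s + t = 2 * n)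
    (hi : i ≠ t) (a : W.obj X s) (b : W.obj X t) :
    W.corrOp hX n n (W.externalCup X X hst a b) i i = 0 := by
  by_cases hi2 : i ≤ 2 * n
  · have h0 : W.IsInducedBy n n (W.externalCup X X hst a b) (0 : W.obj X i →ₗ[K] W.obj X i)
        (show i + (2 * n - i) = 2 * n by omega) (show i + 2 * n + (2 * n - i) = 2 * (n + n) by omega) := by
      intro y z
      rw [LinearMap.zero_apply, LinearMap.map_zero₂, map_zero,
        W.trace_cup_cup_externalCup_of_ne hX hX hst _ (by omega)]
    exact W.eq_of_isInducedBy_of_isInducedBy hX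
      (W.isInducedBy_corrOp hX (nX := n) (c := n) (i := i) (j := i) (by omega)
        (show i + (2 * n - i) = 2 * n by omega) (show i + 2 * n + (2 * n - i) = 2 * (n + n) by omega)
        (W.externalCup X X hst a b)) h0
  · exact W.corrOp_apply_of_not hX (by omega) _

/-- The composite of the rank-one operators of `a ⊠ b` and `c ⊠ d` on `Hᵗ(X)` (`|b| = |d| = t`,
`|a| = |c| = s`) has trace `tr_X(d ∪ a) · tr_X(b ∪ c)` (`Tr(x ↦ φ(x) v) = φ(v)`).
[cite: Kahn2020, §3.5.2 formula (3.5.3)] [cite: Jannsen1992Motives, Lemma 1] -/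
theorem trace_corrOp_externalCup_comp_corrOp_externalCup (hX : IsSmoothProjective n X) {s t : ℕ}
    (hst : s + t = 2 * n) (hts : t + s = 2 * n) (a : W.obj X s) (b : W.obj X t) (c : W.obj X s)
    (d : W.obj X t) :
    LinearMap.trace K (W.obj X t) (W.corrOp hX n n (W.externalCup X X hst a b) t t *
        W.corrOp hX n n (W.externalCup X X hst c d) t t) =
      W.cupPairing X n t s hts d a * W.cupPairing X n t s hts b c := by
  haveI := W.finite_obj hX t
  have h : W.corrOp hX n n (W.externalCup X X hst a b) t t *
      W.corrOp hX n n (W.externalCup X X hst c d) t t =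
        ((W.cupPairing X n t s hts).flip c).smulRight (W.cupPairing X n t s hts d a • b) := by
    refine LinearMap.ext fun x ↦ ?_
    rw [Module.End.mul_apply, W.corrOp_externalCup_apply hX hst hts c d x,
      map_smul, W.corrOp_externalCup_apply hX hst hts a b d, LinearMap.smulRight_apply,
      LinearMap.flip_apply]
  rw [h, LinearMap.trace_smulRight, LinearMap.flip_apply, map_smul, LinearMap.smul_apply,
    smul_eq_mul]

end ExternalCup

/-! ## Transposition bookkeeping -/

section Transpose

variable {m : ℕ} {Y : SchemeOver k}

/-- `ᵗᵗw = w`: transposing twice is the identity (`σ ∘ σ = id`). [cite: Kleiman1968AlgebraicCycles, §1.3] -/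
theorem transposeClass_transposeClass {d : ℕ} (w : W.obj (X ⊗ Y) d) :
    W.transposeClass (W.transposeClass w) = w := by
  rw [transposeClass_apply, transposeClass_apply, ← LinearMap.comp_apply, ← W.pullback_comp,
    SymmetricCategory.symmetry, W.pullback_id, LinearMap.id_apply]

/-- Transposition is additive. [cite: Kleiman1968AlgebraicCycles, §1.3] -/
theorem transposeClass_add {d : ℕ} (w w' : W.obj (X ⊗ Y) d) :
    W.transposeClass (w + w') = W.transposeClass w + W.transposeClass w' := by
  simp [transposeClass_apply]

/-- Transposition is `K`-linear. [cite: Kleiman1968AlgebraicCycles, §1.3] -/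
theorem transposeClass_smul {d : ℕ} (c : K) (w : W.obj (X ⊗ Y) d) :
    W.transposeClass (c • w) = c • W.transposeClass w := by
  simp [transposeClass_apply]

/-- Transposition sends `0` to `0`. [cite: Kleiman1968AlgebraicCycles, §1.3] -/
theorem transposeClass_zero {d : ℕ} : W.transposeClass (0 : W.obj (X ⊗ Y) d) = 0 := by
  simp [transposeClass_apply]

/-- The transpose of a rational algebraic class is rational algebraic (pull-back along the swap,
axiom `pullback_ratAlgebraicClasses_le`). [cite: Kleiman1968AlgebraicCycles, §1.3] -/
theorem transposeClass_mem_ratAlgebraicClasses (hX : IsSmoothProjective n X)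
    (hY : IsSmoothProjective m Y) {c : ℕ} {w : W.obj (X ⊗ Y) (2 * c)}
    (hw : w ∈ W.ratAlgebraicClasses (X ⊗ Y) c) :
    W.transposeClass w ∈ W.ratAlgebraicClasses (Y ⊗ X) c := by
  rw [transposeClass_apply]
  exact W.pullback_ratAlgebraicClasses_le (isSmoothProjective_tensor hY hX)
    (isSmoothProjective_tensor hX hY) (β_ Y X).hom c ⟨w, hw, rfl⟩

end Transpose

/-! ## Jannsen's Lemma 1 -/

section Lemma1

/-- The left-hand side `Σ_i (-1)^i Tr((a ⊠ b)_* ∘ (c ⊠ d)_* | Hⁱ(X))` on generators of matching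
degrees (`|a| = |c| = s`, `|b| = |d| = t`, `s + t = 2n`): only `i = t` contributes, giving
`(-1)ᵗ tr_X(d ∪ a) tr_X(b ∪ c)`. [cite: Jannsen1992Motives, Lemma 1] [cite: Kahn2020, §3.5.2 formula (3.5.3)] -/
theorem sum_trace_corrOp_externalCup_comp_corrOp_externalCup (hX : IsSmoothProjective n X)
    {s t : ℕ} (hst : s + t = 2 * n) (hts : t + s = 2 * n) (a : W.obj X s) (b : W.obj X t)
    (c : W.obj X s) (d : W.obj X t) :
    ∑ i ∈ Finset.range (2 * n + 1), (-1 : K) ^ i *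
        LinearMap.trace K (W.obj X i) (W.corrOp hX n n (W.externalCup X X hst a b) i i *
          W.corrOp hX n n (W.externalCup X X hst c d) i i) =
      (-1 : K) ^ t * (W.cupPairing X n t s hts d a * W.cupPairing X n t s hts b c) := by
  rw [Finset.sum_eq_single_of_mem t (Finset.mem_range.mpr (by omega))]
  · rw [W.trace_corrOp_externalCup_comp_corrOp_externalCup hX hst hts a b c d]
  · intro i _ hit
    rw [W.corrOp_externalCup_eq_zero hX hst hit a b, zero_mul, map_zero, mul_zero]

/-- The left-hand side on generators of NON-matching degrees (`|b| = t ≠ t' = |d|`): every summand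
vanishes, one of the two operators being `0` in each degree. [cite: Jannsen1992Motives, Lemma 1] -/
theorem sum_trace_corrOp_externalCup_comp_corrOp_externalCup_of_ne (hX : IsSmoothProjective n X)
    {s t s' t' : ℕ} (hst : s + t = 2 * n) (hst' : s' + t' = 2 * n) (htt : t' ≠ t) (a : W.obj X s)
    (b : W.obj X t) (c : W.obj X s') (d : W.obj X t') :
    ∑ i ∈ Finset.range (2 * n + 1), (-1 : K) ^ i *
        LinearMap.trace K (W.obj X i) (W.corrOp hX n n (W.externalCup X X hst a b) i i *
          W.corrOp hX n n (W.externalCup X X hst' c d) i i) = 0 := by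
  refine Finset.sum_eq_zero fun i _ ↦ ?_
  by_cases hit : i = t
  · rw [W.corrOp_externalCup_eq_zero hX hst' (fun h ↦ htt (hit ▸ h.symm)) c d, mul_zero, map_zero,
      mul_zero]
  · rw [W.corrOp_externalCup_eq_zero hX hst hit a b, zero_mul, map_zero, mul_zero]

/-- The right-hand side `tr_{X×X}((a ⊠ b) ∪ ᵗ(c ⊠ d))` on generators of matching degrees
(`|a| = |c| = s`, `|b| = |d| = t`): `ᵗ(c ⊠ d) = (-1)^{st} d ⊠ c` (Kahn (3.5.4)) and
`tr((a ⊠ b) ∪ (d ⊠ c)) = tr((a ⊠ b)_* d ∪ c)` (the pairing form of the action), so it is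
`(-1)^{st} tr_X(d ∪ a) tr_X(b ∪ c)`. [cite: Jannsen1992Motives, Lemma 1] [cite: Kahn2020, §3.5.3 formula (3.5.4)] -/
theorem trace_externalCup_cup_transposeClass_externalCup (hX : IsSmoothProjective n X)
    {s t : ℕ} (hst : s + t = 2 * n) (hts : t + s = 2 * n) (a : W.obj X s) (b : W.obj X t)
    (c : W.obj X s) (d : W.obj X t) (H : 2 * n + 2 * n = 2 * (n + n)) :
    W.trace (X ⊗ X) (n + n) (W.cup H (W.externalCup X X hst a b)
        (W.transposeClass (W.externalCup X X hst c d))) =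
      (((s : ℤ) * t).negOnePow : ℤ) • (W.cupPairing X n t s hts d a * W.cupPairing X n t s hts b c) := by
  rw [W.transposeClass_externalCup hX hX hst hts c d, LinearMap.map_smul_of_tower, map_zsmul]
  congr 1
  rw [W.trace_cup_externalCup_of_isInducedBy hX hts
      (W.isInducedBy_corrOp hX (nX := n) (c := n) (i := t) (j := t) (by omega) hts
        (show t + 2 * n + s = 2 * (n + n) by omega) (W.externalCup X X hst a b)) H d c,
    W.corrOp_externalCup_apply hX hst hts a b d, map_smul, LinearMap.smul_apply, map_smul,
    smul_eq_mul, cupPairing_apply, cupPairing_apply]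

/-- The right-hand side on generators of NON-matching degrees (`|b| = t ≠ t' = |d|`) vanishes:
`(a ⊠ b)_*` is `0` on `H^{t'}(X)`. [cite: Jannsen1992Motives, Lemma 1] -/
theorem trace_externalCup_cup_transposeClass_externalCup_of_ne (hX : IsSmoothProjective n X)
    {s t s' t' : ℕ} (hst : s + t = 2 * n) (hst' : s' + t' = 2 * n) (htt : t' ≠ t) (a : W.obj X s)
    (b : W.obj X t) (c : W.obj X s') (d : W.obj X t') (H : 2 * n + 2 * n = 2 * (n + n)) :
    W.trace (X ⊗ X) (n + n) (W.cup H (W.externalCup X X hst a b)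
        (W.transposeClass (W.externalCup X X hst' c d))) = 0 := by
  have ht's' : t' + s' = 2 * n := by omega
  rw [W.transposeClass_externalCup hX hX hst' ht's' c d, LinearMap.map_smul_of_tower, map_zsmul,
    W.trace_cup_externalCup_of_isInducedBy hX ht's'
      (W.isInducedBy_corrOp hX (nX := n) (c := n) (i := t') (j := t') (by omega) ht's'
        (show t' + 2 * n + s' = 2 * (n + n) by omega) (W.externalCup X X hst a b)) H d c,
    W.corrOp_externalCup_eq_zero hX hst htt a b, LinearMap.zero_apply, LinearMap.map_zero₂,
    map_zero, smul_zero]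

omit [CharZero K] in
/-- The sign bookkeeping of Lemma 1: for `s + t = 2n`, `(-1)^{st} = (-1)ᵗ` (as `st ≡ t² ≡ t`).
[cite: Kahn2020, §3.5.3 formula (3.5.4)] -/
theorem cast_negOnePow_mul_eq_neg_one_pow {s t : ℕ} (hst : s + t = 2 * n) :
    ((((s : ℤ) * t).negOnePow : ℤ) : K) = (-1 : K) ^ t := by
  have h : ((s : ℤ) * t).negOnePow = (t : ℤ).negOnePow := by
    rw [Int.negOnePow_eq_iff]
    rcases Nat.even_or_odd t with ⟨r, hr⟩ | ⟨r, hr⟩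
    · exact ⟨((s : ℤ) - 1) * r, by rw [hr]; push_cast; ring⟩
    · have hs : (s : ℤ) = 2 * n - 2 * r - 1 := by omega
      exact ⟨((n : ℤ) - r - 1) * t, by rw [hs, hr]; push_cast; ring⟩
  rw [h, Int.cast_negOnePow_natCast]

/-- **JANNSEN'S LEMMA 1 for the constructed actions** (Kleiman 1968 Prop. 1.3.6 for a composite):
for `u, w ∈ H²ⁿ(X × X)`, `tr_{X×X}(u ∪ ᵗw) = Σ_{i=0}^{2n} (-1)^i Tr(u_* ∘ w_* | Hⁱ(X))`, where
`u_* = W.corrOp hX n n u i i` is the operator `pr₂₊(pr₁* (·) ∪ u)` of `u` on `Hⁱ(X)` and `ᵗw = σ* w`.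
Both sides are bilinear; Künneth induction reduces to external products, computed in
`sum_trace_corrOp_externalCup_comp_corrOp_externalCup` and
`trace_externalCup_cup_transposeClass_externalCup`, whose signs agree by
`cast_negOnePow_mul_eq_neg_one_pow`. [cite: Jannsen1992Motives, Lemma 1]
[cite: Kleiman1968AlgebraicCycles, Prop. 1.3.6] -/
theorem trace_cup_transposeClass_eq_sum_trace_corrOp_comp (hX : IsSmoothProjective n X)
    (u w : W.obj (X ⊗ X) (2 * n)) (H : 2 * n + 2 * n = 2 * (n + n)) :
    W.trace (X ⊗ X) (n + n) (W.cup H u (W.transposeClass w)) =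
      ∑ i ∈ Finset.range (2 * n + 1), (-1 : K) ^ i *
        LinearMap.trace K (W.obj X i) (W.corrOp hX n n u i i * W.corrOp hX n n w i i) := by
  induction u using W.kunneth_induction hX hX generalizing w with
  | zero => simp
  | add u u' hu hu' =>
    simp only [map_add, LinearMap.add_apply, hu, hu', ← Finset.sum_add_distrib]
    refine Finset.sum_congr rfl fun i _ ↦ ?_
    rw [Pi.add_apply, Pi.add_apply, add_mul, map_add, mul_add]
  | ext s t hst a b =>
    induction w using W.kunneth_induction hX hX with
    | zero => simp [W.transposeClass_zero]
    | add w w' hw hw' =>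
      simp only [W.transposeClass_add, map_add, hw, hw', ← Finset.sum_add_distrib]
      refine Finset.sum_congr rfl fun i _ ↦ ?_
      rw [Pi.add_apply, Pi.add_apply, mul_add, map_add, mul_add]
    | ext s' t' hst' c d =>
      by_cases htt : t' = t
      · subst htt
        obtain rfl : s' = s := by omega
        rw [W.trace_externalCup_cup_transposeClass_externalCup hX hst (by omega) a b c d H,
          W.sum_trace_corrOp_externalCup_comp_corrOp_externalCup hX hst (by omega) a b c d,
          zsmul_eq_mul, cast_negOnePow_mul_eq_neg_one_pow hst]
      · rw [W.trace_externalCup_cup_transposeClass_externalCup_of_ne hX hst hst' htt a b c d H,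
          W.sum_trace_corrOp_externalCup_comp_corrOp_externalCup_of_ne hX hst hst' htt a b c d]

/-- **JANNSEN'S LEMMA 1** (`⟨f · ᵗg⟩ = Σ_{i=0}^{2 dim X} (-1)^i Tr_i(f ∘ g)`; Kleiman 1968
Prop. 1.3.6), relational form: let `u, w ∈ H²ⁿ(X × X)` induce, in Kleiman's pairing sense
`W.IsInducedBy`, the degree-preserving operators `S = (S_i)`, `T = (T_i)` on all `Hⁱ(X)` (as the
classes of two correspondences `f`, `g` of degree `0` do; the composite correspondence `f ∘ g`
then acts by `S_i ∘ T_i`, Kleiman §1.3). Then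
`tr_{X×X}(u ∪ ᵗw) = Σ_{i=0}^{2n} (-1)^i Tr(S_i ∘ T_i | Hⁱ(X))`.
(The induced operators are unique, `eq_of_isInducedBy_of_isInducedBy`, so this is
`trace_cup_transposeClass_eq_sum_trace_corrOp_comp`.) [cite: Jannsen1992Motives, Lemma 1]
[cite: Kleiman1968AlgebraicCycles, Prop. 1.3.6] -/
theorem trace_cup_transposeClass_eq_sum_trace_comp_of_isInducedBy (hX : IsSmoothProjective n X)
    {u w : W.obj (X ⊗ X) (2 * n)} (S T : ∀ i : ℕ, W.obj X i →ₗ[K] W.obj X i)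
    (hS : ∀ (i j' : ℕ) (h : i + j' = 2 * n),
      W.IsInducedBy n n u (S i) h (show i + 2 * n + j' = 2 * (n + n) by omega))
    (hT : ∀ (i j' : ℕ) (h : i + j' = 2 * n),
      W.IsInducedBy n n w (T i) h (show i + 2 * n + j' = 2 * (n + n) by omega))
    (H : 2 * n + 2 * n = 2 * (n + n)) :
    W.trace (X ⊗ X) (n + n) (W.cup H u (W.transposeClass w)) =
      ∑ i ∈ Finset.range (2 * n + 1), (-1 : K) ^ i *
        LinearMap.trace K (W.obj X i) (S i * T i) := by
  rw [W.trace_cup_transposeClass_eq_sum_trace_corrOp_comp hX u w H]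
  refine Finset.sum_congr rfl fun i hi ↦ ?_
  have hi' : i + (2 * n - i) = 2 * n := by have := Finset.mem_range.mp hi; omega
  have eS : W.corrOp hX n n u i i = S i :=
    W.eq_of_isInducedBy_of_isInducedBy hX
      (W.isInducedBy_corrOp hX (nX := n) (c := n) (i := i) (j := i) (by omega) hi'
        (show i + 2 * n + (2 * n - i) = 2 * (n + n) by omega) u) (hS i _ hi')
  have eT : W.corrOp hX n n w i i = T i :=
    W.eq_of_isInducedBy_of_isInducedBy hX
      (W.isInducedBy_corrOp hX (nX := n) (c := n) (i := i) (j := i) (by omega) hi'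
        (show i + 2 * n + (2 * n - i) = 2 * (n + n) by omega) w) (hT i _ hi')
  rw [eS, eT]

/-- **The alternating trace of a composite is symmetric**: `Σ (-1)^i Tr(S_i T_i) = Σ (-1)^i Tr(T_i S_i)`
for any degree-preserving operators (degreewise `Tr(AB) = Tr(BA)`), so that Lemma 1 gives the
symmetry of the intersection form below. [cite: Jannsen1992Motives, Lemma 1] -/
theorem sum_trace_comp_comm (S T : ∀ i : ℕ, W.obj X i →ₗ[K] W.obj X i) :
    ∑ i ∈ Finset.range (2 * n + 1), (-1 : K) ^ i * LinearMap.trace K (W.obj X i) (S i * T i) =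
      ∑ i ∈ Finset.range (2 * n + 1), (-1 : K) ^ i * LinearMap.trace K (W.obj X i) (T i * S i) :=
  Finset.sum_congr rfl fun i _ ↦ by rw [LinearMap.trace_mul_comm]

/-- **Symmetry of the intersection form on correspondences of degree `0`**:
`⟨u · ᵗw⟩ = ⟨w · ᵗu⟩`, i.e. `tr_{X×X}(u ∪ ᵗw) = tr_{X×X}(w ∪ ᵗu)` for all `u, w ∈ H²ⁿ(X × X)`
(Lemma 1 on both sides and `Tr(AB) = Tr(BA)`). [cite: Jannsen1992Motives, Lemma 1]
[cite: Kleiman1968AlgebraicCycles, Prop. 1.3.6] -/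
theorem trace_cup_transposeClass_comm (hX : IsSmoothProjective n X) (u w : W.obj (X ⊗ X) (2 * n))
    (H : 2 * n + 2 * n = 2 * (n + n)) :
    W.trace (X ⊗ X) (n + n) (W.cup H u (W.transposeClass w)) =
      W.trace (X ⊗ X) (n + n) (W.cup H w (W.transposeClass u)) := by
  rw [W.trace_cup_transposeClass_eq_sum_trace_corrOp_comp hX u w H,
    W.trace_cup_transposeClass_eq_sum_trace_corrOp_comp hX w u H]
  exact W.sum_trace_comp_comm _ _

/-- `⟨u · w⟩ = ⟨ᵗu · ᵗw⟩`-type rewriting used with Lemma 1: `tr_{X×X}(u ∪ w) = tr_{X×X}(ᵗu ∪ ᵗw)`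
(the tree's `trace_cup_transposeClass`, recorded in the degree `2n + 2n` used here).
[cite: Kleiman1968AlgebraicCycles, §1.3] -/
theorem trace_cup_eq_trace_cup_transposeClass (hX : IsSmoothProjective n X)
    (u w : W.obj (X ⊗ X) (2 * n)) (H : 2 * n + 2 * n = 2 * (n + n)) :
    W.trace (X ⊗ X) (n + n) (W.cup H u w) =
      W.trace (X ⊗ X) (n + n) (W.cup H (W.transposeClass u) (W.transposeClass w)) :=
  (W.trace_cup_transposeClass hX hX H H u w).symm

/-- **Lemma 1 with the transpose on the operator side**: for `u, v ∈ H²ⁿ(X × X)` inducing `S` and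
(`ᵗv` inducing) `T'` — i.e. `T'` is induced by the transposed class `σ* v` — one has
`tr_{X×X}(u ∪ v) = Σ (-1)^i Tr(S_i ∘ T'_i)` (apply Lemma 1 to `w = ᵗv`, `ᵗᵗv = v`). This is the
form "`⟨f · h⟩ = Σ (-1)^i Tr_i(f ∘ ᵗh)`" by which numerical triviality of `f` (vanishing of
`⟨f · h⟩` for all algebraic `h`) is read off traces. [cite: Jannsen1992Motives, Lemma 1 and proof of Thm. 1] -/
theorem trace_cup_eq_sum_trace_comp_of_isInducedBy_transposeClass (hX : IsSmoothProjective n X)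
    {u v : W.obj (X ⊗ X) (2 * n)} (S T' : ∀ i : ℕ, W.obj X i →ₗ[K] W.obj X i)
    (hS : ∀ (i j' : ℕ) (h : i + j' = 2 * n),
      W.IsInducedBy n n u (S i) h (show i + 2 * n + j' = 2 * (n + n) by omega))
    (hT' : ∀ (i j' : ℕ) (h : i + j' = 2 * n),
      W.IsInducedBy n n (W.transposeClass v) (T' i) h (show i + 2 * n + j' = 2 * (n + n) by omega))
    (H : 2 * n + 2 * n = 2 * (n + n)) :
    W.trace (X ⊗ X) (n + n) (W.cup H u v) =
      ∑ i ∈ Finset.range (2 * n + 1), (-1 : K) ^ i *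
        LinearMap.trace K (W.obj X i) (S i * T' i) := by
  rw [← W.trace_cup_transposeClass_eq_sum_trace_comp_of_isInducedBy hX S T' hS hT' H,
    W.transposeClass_transposeClass]

end Lemma1

end WeilCohomology

end Literature.AlgebraicGeometry.Motives

end
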